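import Summits.AtomisticToContinuum.HydrodynamicLimit.Theses.ImplosionDichotomy

/-!
# The hard-sphere equation of state at low density: the analytic assembly

Stub `stub_eosAssembly` (E3) of the line `log-lipschitz-budget` (crux
`ImplosionDichotomy.PolynomialCompression`, stmt-AtomisticToContinuum-12587).

Given the analytic insertion factor `Rf` of the hard-sphere gas (a real power series at `0` of
radius `r`, `Rf 0 = 1`, `Rf′(0) = 4π/3`) and the thermodynamic limit
`−N⁻¹ log hsFreeVolume η N → ∫₀¹ log Rf(ηs) ds` for `η ∈ [0, η₂)`, the route support item
`HsEosLowDensity` holds with the witness `F(η) := ∫₀¹ log Rf(ηs) ds`: `F` is real-analytic on a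
neighbourhood `(−η₀, η₀)` of `0`, agrees with `hsExcessFreeEnergy` on `[0, η₀)`, `F 0 = 0`,
`F′(0) = 2π/3`, and the free-volume limit exists and equals `F` on `[0, η₀)`.

The only analysis is the pure power-series lemma
`hasFPowerSeriesOnBall_intervalIntegral_comp_mul`: if `g = ∑ aₖ xᵏ` on the ball of radius `ρ`
about `0`, then `η ↦ ∫₀¹ g(ηs) ds = ∑ aₖ ηᵏ/(k+1)` on the same ball (termwise integration,
dominated convergence), applied to `g := log ∘ Rf`, which is analytic at `0` since `Rf 0 = 1 > 0`.
-/

noncomputable section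

namespace Summit.AtomisticToContinuum.HydrodynamicLimit.Theorems

open Set MeasureTheory Filter
open scoped Topology ENNReal NNReal
open Literature.MathematicalPhysics.KineticTheory
open Literature.Analysis.FunctionSpaces

/-- **Termwise integration of a power series in a multiplicative parameter.** If `g` has the
power series `q = ∑ aₖ xᵏ` on the ball of radius `ρ` about `0`, then the parametric integral
`η ↦ ∫₀¹ g(η s) ds` has the power series `∑ (aₖ/(k+1)) ηᵏ` on the same ball. [folklore] -/
theorem hasFPowerSeriesOnBall_intervalIntegral_comp_mul {g : ℝ → ℝ}
    {q : FormalMultilinearSeries ℝ ℝ ℝ} {ρ : ℝ}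
    (hq : HasFPowerSeriesOnBall g q 0 (ENNReal.ofReal ρ)) :
    HasFPowerSeriesOnBall (fun η => ∫ s in (0 : ℝ)..1, g (η * s))
      (FormalMultilinearSeries.ofScalars ℝ (fun k => q.coeff k / (k + 1))) 0
      (ENNReal.ofReal ρ) := by
  refine ⟨?_, hq.r_pos, ?_⟩
  · -- the radius of `∑ (aₖ/(k+1)) ηᵏ` is at least that of `q`
    refine ENNReal.le_of_forall_nnreal_lt fun t ht => ?_
    obtain ⟨C, -, hC⟩ := q.norm_mul_pow_le_of_lt_radius (ht.trans_le hq.r_le)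
    refine FormalMultilinearSeries.le_radius_of_bound _ C fun n => le_trans ?_ (hC n)
    refine mul_le_mul_of_nonneg_right ?_ (by positivity)
    rw [FormalMultilinearSeries.ofScalars_norm, FormalMultilinearSeries.norm_apply_eq_norm_coef,
      norm_div]
    refine div_le_self (norm_nonneg _) ?_
    rw [Real.norm_of_nonneg (by positivity)]
    linarith [n.cast_nonneg (α := ℝ)]
  · intro η hη
    have hηρ : ‖η‖ < ρ := by
      rw [Metric.eball_ofReal, mem_ball_zero_iff] at hη
      exact hη
    have hηq : η ∈ Metric.eball (0 : ℝ) q.radius := Metric.eball_subset_eball hq.r_le hη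
    have hterm : ∀ n : ℕ,
        ∫ s in (0 : ℝ)..1, (η * s) ^ n * q.coeff n = q.coeff n / (n + 1) * η ^ n := by
      intro n
      simp_rw [mul_pow]
      rw [intervalIntegral.integral_mul_const, intervalIntegral.integral_const_mul, integral_pow]
      simp only [one_pow, ne_eq, Nat.add_eq_zero_iff, one_ne_zero, and_false, not_false_eq_true,
        zero_pow, sub_zero]
      ring
    have key : HasSum (fun n : ℕ => ∫ s in (0 : ℝ)..1, (η * s) ^ n * q.coeff n)
        (∫ s in (0 : ℝ)..1, g (η * s)) := by
      refine intervalIntegral.hasSum_integral_of_dominated_convergence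
        (fun n _ => ‖q n fun _ => η‖) (fun n => ?_) (fun n => ?_) ?_ ?_ ?_
      · exact (by fun_prop : Continuous fun s : ℝ => (η * s) ^ n * q.coeff n).aestronglyMeasurable
      · refine Eventually.of_forall fun s hs => ?_
        rw [Set.uIoc_of_le zero_le_one] at hs
        have hs1 : ‖s‖ ≤ 1 := by
          rw [Real.norm_of_nonneg hs.1.le]
          exact hs.2
        rw [FormalMultilinearSeries.apply_eq_pow_smul_coeff, norm_smul, norm_mul, norm_pow,
          norm_pow, norm_mul]
        refine mul_le_mul_of_nonneg_right ?_ (norm_nonneg _)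
        exact pow_le_pow_left₀ (by positivity) (mul_le_of_le_one_right (norm_nonneg _) hs1) n
      · exact Eventually.of_forall fun s _ => q.summable_norm_apply hηq
      · exact intervalIntegrable_const
      · refine Eventually.of_forall fun s hs => ?_
        rw [Set.uIoc_of_le zero_le_one] at hs
        have hs1 : ‖s‖ ≤ 1 := by
          rw [Real.norm_of_nonneg hs.1.le]
          exact hs.2
        have hmem : η * s ∈ Metric.eball (0 : ℝ) (ENNReal.ofReal ρ) := by
          rw [Metric.eball_ofReal, mem_ball_zero_iff, norm_mul]
          calc ‖η‖ * ‖s‖ ≤ ‖η‖ * 1 := by gcongr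
            _ < ρ := by rw [mul_one]; exact hηρ
        simpa only [zero_add, FormalMultilinearSeries.apply_eq_pow_smul_coeff, smul_eq_mul]
          using hq.hasSum hmem
    simpa only [zero_add, FormalMultilinearSeries.ofScalars_apply_eq, smul_eq_mul, hterm]
      using key

/-- **Stub `stub_eosAssembly` (E3) of the line `log-lipschitz-budget`.** The analytic insertion
factor `Rf` (power series at `0` of radius `r`, `Rf 0 = 1`, `Rf′(0) = 4π/3`, positive on
`(−r, r)`) and the thermodynamic limit `−N⁻¹ log hsFreeVolume η N → ∫₀¹ log Rf(ηs) ds` for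
`η ∈ [0, η₂)` give the route support item `HsEosLowDensity` with `F(η) := ∫₀¹ log Rf(ηs) ds`:
`F` analytic on `(−η₀, η₀)`, `F = hsExcessFreeEnergy` on `[0, η₀)`, `F 0 = 0`, `F′(0) = 2π/3`,
and the limit clause. [folklore] -/
theorem stub_eosAssembly :
    ∀ (Rf : ℝ → ℝ) (r : ℝ), 0 < r →
      (∃ p : FormalMultilinearSeries ℝ ℝ ℝ, HasFPowerSeriesOnBall Rf p 0 (ENNReal.ofReal r)) →
      Rf 0 = 1 → deriv Rf 0 = 4 * Real.pi / 3 → (∀ x ∈ Ioo (-r) r, 0 < Rf x) →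
      ∀ η₂ : ℝ, 0 < η₂ → η₂ ≤ r →
        (∀ η ∈ Ico 0 η₂, Tendsto (fun N : ℕ => -(N : ℝ)⁻¹ * Real.log (hsFreeVolume η N)) atTop
          (nhds (∫ s in (0 : ℝ)..1, Real.log (Rf (η * s))))) →
        Summit.AtomisticToContinuum.HydrodynamicLimit.Theses.ImplosionDichotomy.HsEosLowDensity := by
  intro Rf r _hr hps h0 hd _hpos η₂ hη₂ _hη₂r hlim
  unfold Summit.AtomisticToContinuum.HydrodynamicLimit.Theses.ImplosionDichotomy.HsEosLowDensity
  obtain ⟨p, hp⟩ := hps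
  have hRf : AnalyticAt ℝ Rf 0 := hp.analyticAt
  have hRf0 : 0 < Rf 0 := by
    rw [h0]
    exact one_pos
  -- `g := log ∘ Rf` is analytic at `0`, with some power series `q` of positive radius `ρ`
  obtain ⟨q, ρ, hq⟩ := hRf.log hRf0
  obtain ⟨ρ₁, hρ₁0, hρ₁⟩ : ∃ ρ₁ : ℝ, 0 < ρ₁ ∧ ENNReal.ofReal ρ₁ < ρ := by
    obtain ⟨ρ₁, -, h1, h2⟩ := ENNReal.lt_iff_exists_real_btwn.1 hq.r_pos
    exact ⟨ρ₁, ENNReal.ofReal_pos.1 h1, h2⟩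
  have hη₀ : 0 < min ρ₁ η₂ := lt_min hρ₁0 hη₂
  have hq' : HasFPowerSeriesOnBall (fun x => Real.log (Rf x)) q 0 (ENNReal.ofReal (min ρ₁ η₂)) :=
    hq.mono (ENNReal.ofReal_pos.2 hη₀)
      ((ENNReal.ofReal_le_ofReal (min_le_left _ _)).trans hρ₁.le)
  -- the power series of `F η := ∫₀¹ log Rf(ηs) ds` on the ball of radius `η₀ := min ρ₁ η₂`
  have hF := hasFPowerSeriesOnBall_intervalIntegral_comp_mul hq'
  -- `a₁ = (log ∘ Rf)′(0) = Rf′(0)/Rf 0 = 4π/3`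
  have h1 : q.coeff 1 = 4 * Real.pi / 3 := by
    have := hq.hasFPowerSeriesAt.deriv
    rw [deriv.log hRf.differentiableAt hRf0.ne', hd, h0, div_one,
      FormalMultilinearSeries.apply_eq_pow_smul_coeff, one_pow, one_smul] at this
    exact this.symm
  refine ⟨min ρ₁ η₂, hη₀, fun η => ∫ s in (0 : ℝ)..1, Real.log (Rf (η * s)), ?_, ?_, ?_, ?_, ?_⟩
  · -- analyticity on `(−η₀, η₀)`
    have := hF.analyticOnNhd
    rwa [Metric.eball_ofReal, Real.ball_eq_Ioo, zero_sub, zero_add] at this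
  · -- agreement with `hsExcessFreeEnergy` (a `limsup`) on `[0, η₀)`
    intro η hη
    unfold hsExcessFreeEnergy
    exact (hlim η ⟨hη.1, hη.2.trans_le (min_le_right _ _)⟩).limsup_eq
  · -- `F 0 = log (Rf 0) = 0`
    simp [h0]
  · -- `F′(0) = a₁/2 = 2π/3`
    rw [hF.hasFPowerSeriesAt.deriv, FormalMultilinearSeries.ofScalars_apply_eq, h1]
    simp only [Nat.cast_one, one_pow, smul_eq_mul, mul_one]
    ring
  · -- the limit clause is the hypothesis restricted to `[0, η₀) ⊆ [0, η₂)`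
    intro η hη
    exact hlim η ⟨hη.1, hη.2.trans_le (min_le_right _ _)⟩

end Summit.AtomisticToContinuum.HydrodynamicLimit.Theorems
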